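import Summits.AnomalousDissipation.AnomalousDissipation.Theses.MomentParity
import Summits.AnomalousDissipation.AnomalousDissipation.Theorems.QuarticGate.Negative.EnergyRow
import Summits.AnomalousDissipation.AnomalousDissipation.Theorems.MomentParityResolvedDissipationStubStressEnergyEq
import Literature.Analysis.FluidPDE.StatisticalSolutionEnergyEq
import Literature.Analysis.FluidPDE.StatisticalSolutionProofs
import Literature.Analysis.FluidPDE.SteadyNavierStokesEnergy
import Literature.Analysis.FluidPDE.SteadyNavierStokesProofs

/-!
# Stub P1′ `stub_energyEq_of_dominatedFlux` for line `lions-l4-domination` (v3) of crux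
# `MomentParity.ResolvedDissipation` (stmt-AnomalousDissipation-14284)

**The mean energy EQUALITY of stationary statistical solutions with dominated Galerkin fluxes,
`2 ≤ d ≤ 4` (in particular on `T³`).** A stationary statistical solution `μ` of the
space-periodic Navier–Stokes equations at `(ν, f)`, `f ∈ L²`
(`Torus.IsStationaryStatisticalSolution`, FMRT 2001, Ch. IV Def. 1.3), whose Galerkin energy
fluxes `Π_m(u) = ∫ (u ⊗ u) : ∇P_m u` (`Torus.inertialPairing u (P_m u)`) are dominated, for every
order `m` and `μ`-a.e. `u`, by ONE `μ`-integrable function `g`, satisfies the mean energy equality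
`ν ∫ ‖∇u‖² dμ = ∫ (f, u) dμ`, for every real `ν`. In `d = 3` only the inequality is known
unconditionally (FMRT 2001, Ch. IV (1.31)).

The proof is the tree's Galerkin proof of the two-dimensional energy equation
(`Torus.IsStationaryStatisticalSolution.energy_eq_holds`) and of its finite-stress-moment version
(`MomentParityResolvedDissipation.StressEnergyEq.energy_eq_of_stressMoment`): the Liouville
equation tested on `galerkinTest m ha` makes the weighted Galerkin balances vanish in the mean
(`integral_galerkinBalance_eq_zero`), and one lets `m → ∞`, then `a → ∞`, by dominated
convergence, with
* *domination*: the forcing and viscous summands of the balance are bounded by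
  `½ (∫ ‖f‖² + ‖u‖²) + |ν| ‖∇u‖²` (`abs_integral_inner_le`, `truncNormSq_le`,
  `eGradNormSq_fourierTruncate_le`), the flux summand by the hypothesis `|Π_m(u)| ≤ g(u)`;
* *pointwise limit*: `Π_m(u) → 0` for `u ∈ V`, `2 ≤ d ≤ 4`, by `H¹ ⊂ L⁴`
  (`Torus.tendsto_inertialPairing_fourierTruncate_of_card_le_four`), `μ`-a.e. `u ∈ V` by (1.29).

## References

* C. Foias, O. Manley, R. Rosa, R. Temam, *Navier–Stokes Equations and Turbulence*, Cambridge
  Univ. Press (2001), Ch. IV §1.2 Def. 1.3, (1.29)–(1.31); §2 Thm. 2.2; App. B.1. [FMRTTurbulence2001]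
-/

noncomputable section

set_option linter.dupNamespace false

namespace Summit.AnomalousDissipation.AnomalousDissipation.Theorems.MomentParityResolvedDissipation.DominatedFluxEnergyEq

open MeasureTheory Filter Topology
open scoped ENNReal NNReal InnerProductSpace RealInnerProductSpace
open Literature.Analysis.FunctionSpaces Literature.Analysis.FluidPDE
open Summit.AnomalousDissipation.AnomalousDissipation.Theses.MomentParity
open Summit.AnomalousDissipation.AnomalousDissipation.Theorems.QuarticGate.Negative

variable {d : Type*} [Fintype d] [DecidableEq d]

/-- **The mean energy EQUALITY of a stationary statistical solution with dominated Galerkin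
fluxes, `2 ≤ d ≤ 4`, every real `ν`.** If `μ` is a stationary statistical solution of the
space-periodic Navier–Stokes equations at `(ν, f)` (FMRT 2001, Ch. IV Def. 1.3), `f ∈ L²`, and
there is ONE `μ`-integrable `g` with `|∫ (u ⊗ u) : ∇P_m u| ≤ g(u)` for every `m` and `μ`-a.e. `u`,
then `ν ∫ ‖∇u‖² dμ = ∫ (u, f) dμ`.
Proof: the Galerkin argument of `IsStationaryStatisticalSolution.energy_eq_holds`
(`integral_galerkinBalance_eq_zero`, `m → ∞` then `a → ∞` by dominated convergence), the
balance dominated by `½ (∫ ‖f‖² + ‖u‖²) + |ν| ‖∇u‖² + g(u)` (`abs_integral_inner_le`,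
`truncNormSq_le`, `eGradNormSq_fourierTruncate_le`, the hypothesis) and its flux summand tending
to `0` for `μ`-a.e. `u` (`tendsto_inertialPairing_fourierTruncate_of_card_le_four`, finite mean
enstrophy).
[cite: FMRTTurbulence2001, Ch. IV §2 Thm. 2.2 with App. B.1 (d = 2 energy equation); Def. 1.3 (1.29)–(1.31)] -/
theorem energy_eq_of_dominatedFlux (hd2 : 2 ≤ Fintype.card d) (hd4 : Fintype.card d ≤ 4)
    {ν : ℝ} {f : UnitAddTorus d → EuclideanSpace ℝ d} {μ : Measure (Torus.energySpace d)}
    (hμ : Torus.IsStationaryStatisticalSolution ν f μ) (hf : MemLp f 2 volume)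
    (hflux : ∃ g : Torus.energySpace d → ℝ, Integrable g μ ∧
      ∀ m : ℕ, ∀ᵐ u ∂μ, |Torus.inertialPairing u.1 (Torus.fourierTruncate m
        (u.1 : UnitAddTorus d → EuclideanSpace ℝ d))| ≤ g u) :
    ν * (Torus.ensembleEnstrophy μ).toReal = ∫ u, Torus.pairing u.1 f ∂μ := by
  obtain ⟨g, hg_int, hg⟩ := hflux
  haveI := hμ.prob
  obtain ⟨Cw, hCw1, hCw⟩ := Torus.exists_abs_galerkinWeight_le
  have hCw0 : 0 ≤ Cw := zero_le_one.trans hCw1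
  -- abbreviations and integrability
  set G : Torus.energySpace d → ℝ := fun u =>
    (Torus.eGradNormSq (u.1 : UnitAddTorus d → EuclideanSpace ℝ d)).toReal with hG
  set Flim : Torus.energySpace d → ℝ := fun u =>
    (∫ x, ⟪f x, (u.1 : UnitAddTorus d → EuclideanSpace ℝ d) x⟫_ℝ) - ν * G u with hFlim
  have hpair : ∀ u : Torus.energySpace d,
      ∫ x, ⟪f x, (u.1 : UnitAddTorus d → EuclideanSpace ℝ d) x⟫_ℝ = Torus.pairing u.1 f := by
    intro u
    rw [Torus.pairing]
    exact integral_congr_ae (ae_of_all _ fun x => real_inner_comm _ _)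
  have hI1 : Integrable (fun u : Torus.energySpace d => Torus.pairing u.1 f) μ :=
    hμ.integrable_pairing hf
  have hI2 : Integrable G μ := hμ.integrable_toReal_eGradNormSq
  have hFlim_int : Integrable Flim μ := by
    have h : Flim = fun u : Torus.energySpace d => Torus.pairing u.1 f - ν * G u := by
      funext u
      rw [hFlim]
      dsimp only
      rw [hpair]
    rw [h]
    exact hI1.sub (hI2.const_mul ν)
  -- Step 1: for every level `a = n + 1`, `∫ w(|u|²/a) Flim dμ = 0` (limit `m → ∞`)
  have hlevel : ∀ n : ℕ, ∫ u, Torus.galerkinWeight (‖u‖ ^ 2 / ((n : ℝ) + 1)) * Flim u ∂μ = 0 := by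
    intro n
    have ha : (0 : ℝ) < (n : ℝ) + 1 := by positivity
    set a : ℝ := (n : ℝ) + 1 with ha_def
    set F : ℕ → Torus.energySpace d → ℝ := fun m u =>
      Torus.galerkinWeight (Torus.truncNormSq m u / a) * Torus.galerkinBalance ν f m u with hF
    have hFint : ∀ m, Integrable (F m) μ := fun m => (hμ.integral_galerkinBalance_eq_zero m ha).1
    have hFzero : ∀ m, ∫ u, F m u ∂μ = 0 := fun m => (hμ.integral_galerkinBalance_eq_zero m ha).2
    set bound : Torus.energySpace d → ℝ := fun u =>
      Cw * (2⁻¹ * ((∫ x, ‖f x‖ ^ 2) + ‖u‖ ^ 2) + |ν| * G u + g u) with hbound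
    have hbound_int : Integrable bound μ :=
      (((((integrable_const _).add hμ.integrable_norm_sq).const_mul _).add (hI2.const_mul _)).add
        hg_int).const_mul _
    -- domination
    have hdom : ∀ m, ∀ᵐ u ∂μ, ‖F m u‖ ≤ bound u := by
      intro m
      filter_upwards [hμ.ae_eGradNormSq_lt_top, hg m] with u hufin hgu
      have hmem : MemLp (u.1 : UnitAddTorus d → EuclideanSpace ℝ d) 2 volume := Lp.memLp _
      have hint : Integrable (u.1 : UnitAddTorus d → EuclideanSpace ℝ d) volume :=
        hmem.integrable one_le_two
      have hG0 : 0 ≤ G u := ENNReal.toReal_nonneg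
      have hg0 : 0 ≤ g u := (abs_nonneg _).trans hgu
      have hbound0 : 0 ≤ bound u := by rw [hbound]; positivity
      by_cases ht : Torus.truncNormSq m u / a ≤ 2
      · -- on the support of the weight
        have h1 := Torus.abs_integral_inner_le hf (Torus.memLp_fourierTruncate m
          (u.1 : UnitAddTorus d → EuclideanSpace ℝ d) 2)
        have h1' := Torus.truncNormSq_le m u
        have h2 : (Torus.eGradNormSq (Torus.fourierTruncate m
            (u.1 : UnitAddTorus d → EuclideanSpace ℝ d))).toReal ≤ G u :=
          ENNReal.toReal_mono hufin.ne (Torus.eGradNormSq_fourierTruncate_le hint m)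
        have hGm0 : 0 ≤ (Torus.eGradNormSq (Torus.fourierTruncate m
            (u.1 : UnitAddTorus d → EuclideanSpace ℝ d))).toReal := ENNReal.toReal_nonneg
        have hbal : |Torus.galerkinBalance ν f m u| ≤
            2⁻¹ * ((∫ x, ‖f x‖ ^ 2) + ‖u‖ ^ 2) + |ν| * G u + g u := by
          rw [Torus.galerkinBalance]
          refine (abs_add_le _ _).trans ((add_le_add (abs_sub _ _) hgu).trans ?_)
          rw [abs_mul]
          rw [Torus.truncNormSq] at h1'
          nlinarith [abs_nonneg ν, mul_le_mul_of_nonneg_left h2 (abs_nonneg ν),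
            abs_of_nonneg hGm0]
        rw [Real.norm_eq_abs, hF]
        dsimp only
        rw [abs_mul, hbound]
        exact mul_le_mul (hCw _) hbal (abs_nonneg _) hCw0
      · -- off the support the integrand vanishes
        have hw : Torus.galerkinWeight (Torus.truncNormSq m u / a) = 0 :=
          Torus.galerkinWeight_eq_zero ((not_le.1 ht).le.trans (le_abs_self _))
        rw [hF]
        dsimp only
        rw [hw, zero_mul, norm_zero]
        exact hbound0
    -- pointwise limit
    have hlim : ∀ᵐ u ∂μ, Tendsto (fun m => F m u) atTop
        (𝓝 (Torus.galerkinWeight (‖u‖ ^ 2 / a) * Flim u)) := by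
      filter_upwards [hμ.ae_eGradNormSq_lt_top] with u hufin
      have hmem : MemLp (u.1 : UnitAddTorus d → EuclideanSpace ℝ d) 2 volume := Lp.memLp _
      have hint : Integrable (u.1 : UnitAddTorus d → EuclideanSpace ℝ d) volume :=
        hmem.integrable one_le_two
      have tw : Tendsto (fun m => Torus.galerkinWeight (Torus.truncNormSq m u / a)) atTop
          (𝓝 (Torus.galerkinWeight (‖u‖ ^ 2 / a))) :=
        (Torus.continuous_galerkinWeight.tendsto _).comp ((Torus.tendsto_truncNormSq u).div_const a)
      have t1 := Torus.tendsto_integral_inner_fourierTruncate hf hmem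
      have t2 := (Torus.tendsto_toReal_eGradNormSq_fourierTruncate hint hufin.ne).const_mul ν
      have t3 := Torus.tendsto_inertialPairing_fourierTruncate_of_card_le_four hd2 hd4 u.2
        (Torus.memSobolev_one_complexify_of_eGradNormSq_ne_top hmem hufin.ne)
      have tb := (t1.sub t2).add t3
      rw [add_zero] at tb
      exact tw.mul tb
    have hmeas : ∀ m, AEStronglyMeasurable (F m) μ := fun m => (hFint m).aestronglyMeasurable
    have hconv := tendsto_integral_of_dominated_convergence bound hmeas hbound_int hdom hlim
    refine tendsto_nhds_unique hconv ?_
    simp_rw [hFzero]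
    exact tendsto_const_nhds
  -- Step 2: `a → ∞`
  have hlim2 : ∀ u : Torus.energySpace d, Tendsto (fun n : ℕ =>
      Torus.galerkinWeight (‖u‖ ^ 2 / ((n : ℝ) + 1)) * Flim u) atTop (𝓝 (Flim u)) := by
    intro u
    have h1 : Tendsto (fun n : ℕ => ‖u‖ ^ 2 / ((n : ℝ) + 1)) atTop (𝓝 0) := by
      have h := (tendsto_one_div_add_atTop_nhds_zero_nat (𝕜 := ℝ)).const_mul (‖u‖ ^ 2)
      rw [mul_zero] at h
      refine h.congr fun n => ?_
      ring
    have h3 := ((Torus.continuous_galerkinWeight.tendsto 0).comp h1).mul_const (Flim u)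
    rw [Torus.galerkinWeight_zero, one_mul] at h3
    exact h3
  have hdom2 : ∀ n : ℕ, ∀ᵐ u ∂μ,
      ‖Torus.galerkinWeight (‖u‖ ^ 2 / ((n : ℝ) + 1)) * Flim u‖ ≤ Cw * ‖Flim u‖ := by
    intro n
    refine ae_of_all _ fun u => ?_
    rw [norm_mul, Real.norm_eq_abs]
    exact mul_le_mul_of_nonneg_right (hCw _) (norm_nonneg _)
  have hmeas2 : ∀ n : ℕ, AEStronglyMeasurable
      (fun u : Torus.energySpace d => Torus.galerkinWeight (‖u‖ ^ 2 / ((n : ℝ) + 1)) * Flim u) μ := by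
    intro n
    have hc : Continuous fun u : Torus.energySpace d =>
        Torus.galerkinWeight (‖u‖ ^ 2 / ((n : ℝ) + 1)) :=
      Torus.continuous_galerkinWeight.comp ((continuous_norm.pow 2).div_const _)
    exact hc.aestronglyMeasurable.mul hFlim_int.aestronglyMeasurable
  have hconv2 := tendsto_integral_of_dominated_convergence (fun u => Cw * ‖Flim u‖) hmeas2
    (hFlim_int.norm.const_mul Cw) hdom2 (ae_of_all _ hlim2)
  have hFlim0 : ∫ u, Flim u ∂μ = 0 := by
    refine tendsto_nhds_unique hconv2 ?_
    simp_rw [hlevel]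
    exact tendsto_const_nhds
  -- read off the energy equation
  have hsplit : ∫ u, Flim u ∂μ = (∫ u, Torus.pairing u.1 f ∂μ) - ν * ∫ u, G u ∂μ := by
    rw [hFlim]
    simp_rw [hpair]
    rw [integral_sub hI1 (hI2.const_mul ν), integral_const_mul]
  have hens : (Torus.ensembleEnstrophy μ).toReal = ∫ u, G u ∂μ := by
    rw [Torus.ensembleEnstrophy, integral_toReal Torus.measurable_eGradNormSq_coe.aemeasurable
      hμ.ae_eGradNormSq_lt_top]
  rw [hens]
  linarith [hsplit.symm.trans hFlim0]

/-- **P1′ `stub_energyEq_of_dominatedFlux`: the 3-D mean energy EQUALITY under ONE integrable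
dominating function for the Galerkin fluxes** (the `d = 3` companion of the vendored
two-dimensional `Torus.IsStationaryStatisticalSolution.energy_eq`, FMRT 2001, Ch. IV Thm. 2.2 /
App. B.1). A stationary statistical solution `μ` of the Navier–Stokes equations on `T³` at
`(ν, f)`, `f ∈ L²`, whose Galerkin energy fluxes `Π_m(u) = ∫ (u ⊗ u) : ∇P_m u` satisfy
`|Π_m(u)| ≤ g(u)` for every `m` and `μ`-a.e. `u`, with `g` `μ`-integrable, satisfies the mean
energy EQUALITY `ν ∫ ‖∇u‖² dμ = ∫ (u, f) dμ`, for every real `ν`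
(`energy_eq_of_dominatedFlux` with `Fintype.card (Fin 3) = 3`).
[cite: FMRTTurbulence2001, Ch. IV §2 Thm. 2.2 with App. B.1; Def. 1.3 (1.29)–(1.31)] -/
theorem stub_energyEq_of_dominatedFlux :
    ∀ (ν : ℝ) (f : UnitAddTorus (Fin 3) → EuclideanSpace ℝ (Fin 3))
      (μ : Measure (Torus.energySpace (Fin 3))),
      Torus.IsStationaryStatisticalSolution ν f μ → MemLp f 2 volume →
      (∃ g : Torus.energySpace (Fin 3) → ℝ, Integrable g μ ∧
        ∀ m : ℕ, ∀ᵐ u ∂μ, |Torus.inertialPairing u.1 (Torus.fourierTruncate m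
          (u.1 : UnitAddTorus (Fin 3) → EuclideanSpace ℝ (Fin 3)))| ≤ g u) →
      ν * (Torus.ensembleEnstrophy μ).toReal = ∫ u, Torus.pairing u.1 f ∂μ :=
  fun _ _ _ hμ hf hg => energy_eq_of_dominatedFlux (by simp) (by simp) hμ hf hg

end Summit.AnomalousDissipation.AnomalousDissipation.Theorems.MomentParityResolvedDissipation.DominatedFluxEnergyEq

end
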